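import Literature.NumberTheory.Sieve.FriedlanderIwaniecPrimesDirichletSymbol
import Mathlib.Analysis.SpecialFunctions.Complex.Circle
import HarnessLib

/-!
# Friedlander–Iwaniec, *The polynomial `X² + Y⁴` captures its primes*, §20: the Jacobi–Kubota symbol `[z]` and Lemma 20.1

Family `parity`, statement parity.S17 (`setOf_prime_sq_add_pow_four_infinite`). Source: J. Friedlander,
H. Iwaniec, Ann. of Math. (2) 148 (1998), 945–1040 [FriedlanderIwaniecAnnals1998], §20 "Jacobi-Kubota
symbol", (20.1)–(20.15), with the reciprocity law in the signed form (17.6)–(17.7) of §17 (arXiv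
math/9811185, pp. 66, 72–75). Second file of the independent unit §§19–26 of the source (see
`FriedlanderIwaniecPrimesDirichletSymbol` for the map of the unit). Everything here is PROVED; the
definitions are `hilbertInfty` ((17.7)), `recipSign` (the sign of (17.6)), `kubotaEps` ((20.5)–(20.6)),
`kubotaSign` (the parity `ν` of the proof of Lemma 20.1), `jacobiKubota` ((20.1)); no named facts.

## Contents

* `hilbertInfty x y = (x, y)_∞` (`= -1` iff `x, y < 0`), (20.8)–(20.9) `hilbertInfty_comm`,
  `hilbertInfty_mul_right`; `recipSign a b = (-1)^{((a-1)/2)((b-1)/2)}` for odd `a, b` of either sign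
  (read off `a, b mod 4`); **`jacobiSym_natAbs_mul_jacobiSym_natAbs` — the reciprocity law (17.6)**
  `(a/|b|)(b/|a|) = (-1)^{((a-1)/2)((b-1)/2)} (a, b)_∞` for `a, b` odd coprime (from Mathlib's
  `jacobiSym.quadratic_reciprocity'` by the four sign cases).
* The proof of Lemma 20.1 as printed, for `a = Re wz = ur - vs > 0` and `(u,v) = (r,s) = 1`:
  `jacobiSym_r₁_step` (`(r₁/(ur₁ - v₁s)) = sign(r)(-1)^{e(r₁)e(u)}(v₁s/|r₁|)`), `jacobiSym_v₁_step`
  (`(v₁/(ur₁-v₁s)) = (ur,v)_∞ (-1)^{vs/4} (v₁/|ur₁|)`, writing `v₁ = 2^α v'` and evaluating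
  `(2^α/(ur₁-v₁s))(2^α/|ur₁|) = (-1)^{vs/4}` by (20.7)), `jacobiSym_kubota_core_pos` (the chain
  `(b/a) = (us/ρ)(v₁r₁/(ur₁-v₁s))((u²+v²)/(ur₁-v₁s))`, `((u²+v²)/(ur-vs)) = (z/w)`, and
  `(us/ρ)(v₁/|u|)(s/|r₁|) = (-1)^{e(ρ)e(u)}(v/|u|)(s/|r|)`), `jacobiSym_kubota_pos`; the case `a < 0`
  `jacobiSym_kubota_neg` (the source changes `(r, s)` to `(-r, -s)`; we change `(u, s)` to `(-u, -s)`,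
  which equally makes `a > 0` but keeps `b` and `|a|`, so that only signs need comparing:
  `recipSign_neg_left_mul`, `hilbertInfty_neg_flip`); both cases and the vanishing for `(r, s) ≠ 1`:
  **`jacobiSym_kubota`**: `(b/|a|) = ε (-1)^{e(u)e(r) + vs/4} (v/|u|)(s/|r|)(a/q)` with
  `b = Im wz = us + vr`, `q = |w|²`, `ε = kubotaEps u v r s`.
* `jacobiKubota z = [z] = i^{(r-1)/2} (s/|r|)` ((20.1), complex-valued, `i^{·}` an integer power),
  `jacobiKubota_one`, `jacobiKubota_eq_zero_of_not_isPrimitive`; `I_zpow_mul_I_zpow_eq`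
  (`i^{e(u)} i^{e(r)} = i^{e(a)} (-1)^{e(u)e(r)+vs/4}`, the parity `ν`); **`jacobiKubota_mul` —
  Lemma 20.1**: for `w` primary primitive and `z ≡ 1 (mod 2)`, `[wz] = ε [w][z] (z/w)` with
  `ε = (u,v)_∞(r,-v)_∞` if `ur > vs`, `ε = (u,v)_∞(-r,v)_∞` if `ur < vs` ((20.3)–(20.6)).
* (20.12)–(20.15): `two_mul_hilbertInfty`, `two_mul_hilbertInfty_neg_right`,
  `two_mul_hilbertInfty_neg_left`, **`two_mul_kubotaEps_mul_hilbertInfty`** —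
  `2ε(w,z)(u,v)_∞ = 1 + sign(vr) - (sign v - sign r) sign(Re wz)`.

Not here: the refinement (20.2) ("being unable to take advantage of such a refinement, in this paper
we stay with (20.1)"), and the Fourier expansion (20.16)–(20.19) of `sign(Re wz)` (harmonic analysis;
it is used in §21 and is formalised with Proposition 21.4).

## References

* J. Friedlander, H. Iwaniec, Ann. of Math. (2) 148 (1998), 945–1040, §17 (17.6)–(17.7), §20
  (20.1)–(20.15), Lemma 20.1. [FriedlanderIwaniecAnnals1998]
* G. Shimura, Ann. of Math. 97 (1973), 440–481 (the theta multiplier; the source's [Sh], for the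
  analogy in the Remarks after Lemma 20.1).

## Tree / Mathlib

Tree: `dirichletSym`, `dirichletSym_eq`, `natAbs_norm_eq_sq_add_sq`, `re_odd_of_isPrimary`,
`int_gcd_natAbs_cast`, `jacobiSym_eq_zero_of_prime_dvd` (`FriedlanderIwaniecPrimesDirichletSymbol`);
`LFunctions.GaussianInt.IsPrimitive`; `GaussianPrimary.IsPrimary`. Mathlib: `jacobiSym.quadratic_reciprocity'`,
`qrSign.neg_one_pow`, `ZMod.χ₄_nat_eq_if_mod_four`, `ZMod.χ₈_nat_eq_if_mod_eight`, `jacobiSym.neg`,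
`jacobiSym.at_two`, `jacobiSym.mul_left`, `jacobiSym.mul_right'`, `jacobiSym.pow_left`, `jacobiSym.sq_one`,
`jacobiSym.mod_left'`, `jacobiSym.quadratic_reciprocity_one_mod_four`, `Nat.exists_eq_two_pow_mul_odd`,
`Int.gcd_div_gcd_div_gcd`, `IsCoprime.of_isCoprime_of_dvd_left/right`, `IsCoprime.add_mul_left_right`,
`Even.neg_one_zpow`, `Odd.neg_one_zpow`, `Complex.I_mul_I`, `zpow_add₀`.
-/

noncomputable section

open Zsqrtd GaussianInt
open scoped NumberTheorySymbols

namespace Literature.NumberTheory.Sieve.FriedlanderIwaniecPrimes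

open Literature.NumberTheory.QuadraticFields Literature.NumberTheory.QuadraticFields.GaussianPrimary
open Literature.NumberTheory.LFunctions.GaussianInt (IsPrimitive)

local notation "ℤ[i]" => GaussianInt

/-! ### The Hilbert symbol at infinity and the sign of the reciprocity law (17.6) -/

/-- **The Hilbert symbol at `∞`** (17.7)/(§20): `(x, y)_∞ = -1` if `x < 0` and `y < 0`, and `= 1`
otherwise. [cite: FriedlanderIwaniecAnnals1998, (17.7)] -/
def hilbertInfty (x y : ℤ) : ℤ := if x < 0 ∧ y < 0 then -1 else 1

/-- Unfolding `hilbertInfty`. [cite: FriedlanderIwaniecAnnals1998, (17.7)] -/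
theorem hilbertInfty_def (x y : ℤ) : hilbertInfty x y = if x < 0 ∧ y < 0 then -1 else 1 := rfl

/-- (20.8) `(x, y) = (y, x)`. [cite: FriedlanderIwaniecAnnals1998, (20.8)] -/
theorem hilbertInfty_comm (x y : ℤ) : hilbertInfty x y = hilbertInfty y x := by
  unfold hilbertInfty; split_ifs <;> omega

/-- (20.9) `(v, xy) = (v, x)(v, y)` for `x, y ≠ 0`. [cite: FriedlanderIwaniecAnnals1998, (20.9)] -/
theorem hilbertInfty_mul_right (v : ℤ) {x y : ℤ} (hx : x ≠ 0) (hy : y ≠ 0) :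
    hilbertInfty v (x * y) = hilbertInfty v x * hilbertInfty v y := by
  unfold hilbertInfty
  rcases lt_trichotomy x 0 with hx' | hx' | hx'
  · rcases lt_trichotomy y 0 with hy' | hy' | hy'
    · have : 0 < x * y := mul_pos_of_neg_of_neg hx' hy'
      split_ifs <;> omega
    · exact absurd hy' hy
    · have : x * y < 0 := mul_neg_of_neg_of_pos hx' hy'
      split_ifs <;> omega
  · exact absurd hx' hx
  · rcases lt_trichotomy y 0 with hy' | hy' | hy'
    · have : x * y < 0 := mul_neg_of_pos_of_neg hx' hy'
      split_ifs <;> omega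
    · exact absurd hy' hy
    · have : 0 < x * y := mul_pos hx' hy'
      split_ifs <;> omega

/-- The sign `(-1)^{((a-1)/2)((b-1)/2)}` of the reciprocity law (17.6) for odd integers `a`, `b`
(of either sign): it is `-1` exactly when `a ≡ b ≡ 3 (mod 4)`. (The tree has a byte-identical
private-purpose copy `Literature.NumberTheory.EllipticCurves.ModularForms.recipSign` in
`EllipticCurves/ModularCurveEtaMultiplierProofs.lean`, with the one-signed reciprocity
`jacobiSym_eq_recipSign_mul` (`c > 0`); importing the modular-curve eta-multiplier development into
the sieve files for this one-line sign would be disproportionate — a librarian may hoist both to a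
shared quadratic-reciprocity helper. Here the fully signed law (17.6) with the Hilbert symbol is
needed.) [cite: FriedlanderIwaniecAnnals1998, (17.6)] -/
def recipSign (a b : ℤ) : ℤ := if a % 4 = 3 ∧ b % 4 = 3 then -1 else 1

/-- Unfolding `recipSign`. [cite: FriedlanderIwaniecAnnals1998, (17.6)] -/
theorem recipSign_def (a b : ℤ) : recipSign a b = if a % 4 = 3 ∧ b % 4 = 3 then -1 else 1 := rfl

/-- `recipSign` is symmetric. [cite: FriedlanderIwaniecAnnals1998, (17.6)] -/
theorem recipSign_comm (a b : ℤ) : recipSign a b = recipSign b a := by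
  unfold recipSign; split_ifs <;> omega

/-- `χ₄` of an odd natural number as a sign read off `n mod 4`. [folklore] -/
theorem χ₄_nat_eq_ite {n : ℕ} (hn : Odd n) : (ZMod.χ₄ n : ℤ) = if n % 4 = 1 then 1 else -1 := by
  rw [ZMod.χ₄_nat_eq_if_mod_four]
  have : n % 2 = 1 := Nat.odd_iff.mp hn
  rw [if_neg (by omega)]

/-- `qrSign m n = (-1)^{(m/2)(n/2)}` of odd naturals as a sign read off residues mod `4`. [folklore] -/
theorem qrSign_eq_ite {m n : ℕ} (hm : Odd m) (hn : Odd n) :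
    qrSign m n = if m % 4 = 3 ∧ n % 4 = 3 then -1 else 1 := by
  rw [qrSign.neg_one_pow hm hn]
  have hm2 : m % 2 = 1 := Nat.odd_iff.mp hm
  have hn2 : n % 2 = 1 := Nat.odd_iff.mp hn
  by_cases h : m % 4 = 3 ∧ n % 4 = 3
  · rw [if_pos h]
    have h1 : Odd (m / 2) := Nat.odd_iff.mpr (by omega)
    have h2 : Odd (n / 2) := Nat.odd_iff.mpr (by omega)
    exact (h1.mul h2).neg_one_pow
  · rw [if_neg h]
    have : Even (m / 2 * (n / 2)) := by
      rcases not_and_or.mp h with h' | h'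
      · exact (Nat.even_iff.mpr (by omega) : Even (m / 2)).mul_right _
      · exact (Nat.even_iff.mpr (by omega) : Even (n / 2)).mul_left _
    exact this.neg_one_pow

/-- **The reciprocity law in the signed form (17.6)**: for `a`, `b` odd and coprime,
`(a / |b|)(b / |a|) = (-1)^{((a-1)/2)((b-1)/2)} (a, b)_∞`. [cite: FriedlanderIwaniecAnnals1998, (17.6)] -/
theorem jacobiSym_natAbs_mul_jacobiSym_natAbs {a b : ℤ} (ha : Odd a) (hb : Odd b)
    (hab : Int.gcd a b = 1) :
    J(a | b.natAbs) * J(b | a.natAbs) = recipSign a b * hilbertInfty a b := by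
  -- the case of positive odd naturals: `(A / B)(B / A) = qrSign B A`
  have key : ∀ A B : ℕ, Odd A → Odd B → Nat.gcd A B = 1 →
      J((A : ℤ) | B) * J((B : ℤ) | A) = if B % 4 = 3 ∧ A % 4 = 3 then -1 else 1 := by
    intro A B hA hB hAB
    rw [jacobiSym.quadratic_reciprocity' hA hB, mul_assoc, ← sq,
      jacobiSym.sq_one (by rw [Int.gcd_natCast_natCast, Nat.gcd_comm]; exact hAB), mul_one,
      qrSign_eq_ite hB hA]
  obtain ⟨A, ha'⟩ : ∃ A : ℕ, a = A ∨ a = -A := ⟨a.natAbs, Int.natAbs_eq a⟩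
  obtain ⟨B, hb'⟩ : ∃ B : ℕ, b = B ∨ b = -B := ⟨b.natAbs, Int.natAbs_eq b⟩
  have hAeq : a.natAbs = A := by rcases ha' with h | h <;> simp [h]
  have hBeq : b.natAbs = B := by rcases hb' with h | h <;> simp [h]
  have hA : Odd A := hAeq ▸ Int.natAbs_odd.mpr ha
  have hB : Odd B := hBeq ▸ Int.natAbs_odd.mpr hb
  have hAB : Nat.gcd A B = 1 := by rw [← hAeq, ← hBeq, ← Int.gcd_eq_natAbs]; exact hab
  have hk := key _ _ hA hB hAB
  have hχA := χ₄_nat_eq_ite hA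
  have hχB := χ₄_nat_eq_ite hB
  have hA2 : A % 2 = 1 := Nat.odd_iff.mp hA
  have hB2 : B % 2 = 1 := Nat.odd_iff.mp hB
  rw [hAeq, hBeq]
  unfold recipSign hilbertInfty
  rcases ha' with rfl | rfl <;> rcases hb' with rfl | rfl
  · -- `a, b > 0`
    rw [hk]
    split_ifs <;> omega
  · -- `a > 0`, `b < 0`
    rw [jacobiSym.neg _ hA, hχA]
    have e : J((A : ℤ) | B) * ((if A % 4 = 1 then (1 : ℤ) else -1) * J((B : ℤ) | A)) =
        (if A % 4 = 1 then (1 : ℤ) else -1) * (J((A : ℤ) | B) * J((B : ℤ) | A)) := by ring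
    rw [e, hk]
    split_ifs <;> omega
  · -- `a < 0`, `b > 0`
    rw [jacobiSym.neg _ hB, hχB, mul_assoc, hk]
    split_ifs <;> omega
  · -- `a, b < 0`
    rw [jacobiSym.neg _ hB, jacobiSym.neg _ hA, hχA, hχB]
    have e : (if B % 4 = 1 then (1 : ℤ) else -1) * J((A : ℤ) | B) *
        ((if A % 4 = 1 then (1 : ℤ) else -1) * J((B : ℤ) | A)) =
        (if B % 4 = 1 then (1 : ℤ) else -1) * (if A % 4 = 1 then (1 : ℤ) else -1) *
          (J((A : ℤ) | B) * J((B : ℤ) | A)) := by ring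
    rw [e, hk]
    split_ifs <;> omega

/-! ### Small algebraic helpers for the sign computations of Lemma 20.1 -/

/-- From `X Y = Z` and `X² = 1` infer `Y = X Z`. [folklore] -/
theorem eq_mul_of_sq_eq_one {X Y Z : ℤ} (hX : X ^ 2 = 1) (h : X * Y = Z) : Y = X * Z := by
  have : X * (X * Y) = X * Z := by rw [h]
  calc Y = X ^ 2 * Y := by rw [hX, one_mul]
    _ = X * (X * Y) := by ring
    _ = X * Z := this

/-- An odd integer is `≡ 1` or `≡ 3 (mod 4)`. [folklore] -/
theorem emod_four_of_odd {n : ℤ} (hn : Odd n) : n % 4 = 1 ∨ n % 4 = 3 := by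
  have := Int.odd_iff.mp hn; omega

/-- The product of two odd integers modulo `4`. [folklore] -/
theorem mul_emod_four_of_odd {x y : ℤ} (hx : Odd x) (hy : Odd y) :
    (x * y) % 4 = if x % 4 = y % 4 then 1 else 3 := by
  have h := Int.mul_emod x y 4
  rcases emod_four_of_odd hx with hx' | hx' <;> rcases emod_four_of_odd hy with hy' | hy' <;>
    · rw [hx', hy'] at h; norm_num at h; rw [h]; simp [hx', hy']

/-- `recipSign` only depends on the arguments modulo `4`. [cite: FriedlanderIwaniecAnnals1998, (17.6)] -/
theorem recipSign_congr {x m n : ℤ} (h : m % 4 = n % 4) : recipSign x m = recipSign x n := by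
  unfold recipSign; rw [h]

/-- `recipSign x ·` is multiplicative on odd integers (`(-1)^{e(x)(e(m)+e(n))}`, `e(mn) ≡ e(m) + e(n)`).
[cite: FriedlanderIwaniecAnnals1998, (17.6)] -/
theorem recipSign_mul_right (x : ℤ) {m n : ℤ} (hm : Odd m) (hn : Odd n) :
    recipSign x (m * n) = recipSign x m * recipSign x n := by
  unfold recipSign
  rw [mul_emod_four_of_odd hm hn]
  rcases emod_four_of_odd hm with hm' | hm' <;> rcases emod_four_of_odd hn with hn' | hn' <;>
    · by_cases hx : x % 4 = 3 <;> simp [hm', hn', hx]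

/-- `recipSign x n ^ 2 = 1`. [cite: FriedlanderIwaniecAnnals1998, (17.6)] -/
theorem recipSign_sq (x n : ℤ) : recipSign x n ^ 2 = 1 := by
  unfold recipSign; split_ifs <;> norm_num

/-- `hilbertInfty x y = 1` when `y > 0`. [cite: FriedlanderIwaniecAnnals1998, (17.7)] -/
theorem hilbertInfty_of_pos_right (x : ℤ) {y : ℤ} (hy : 0 < y) : hilbertInfty x y = 1 := by
  unfold hilbertInfty; rw [if_neg (by omega)]

/-- `hilbertInfty` only depends on the signs: rescaling the arguments by positive factors.
[cite: FriedlanderIwaniecAnnals1998, (17.7)] -/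
theorem hilbertInfty_congr {x x' y y' : ℤ} (hx : x < 0 ↔ x' < 0) (hy : y < 0 ↔ y' < 0) :
    hilbertInfty x y = hilbertInfty x' y' := by
  simp only [hilbertInfty, hx, hy]

/-- The sign identity `sign(r) (ur, v)_∞ = (u, v)_∞ (r, -v)_∞` for `u, r, v ≠ 0` ("Note also that we
have `(sign r)(ur, v)_∞ = (sign r)(r, v)_∞ (u, v)_∞ = (r, -v)_∞ (u, v)_∞ = ε`").
[cite: FriedlanderIwaniecAnnals1998, Lemma 20.1 (proof)] -/
theorem sign_mul_hilbertInfty_mul {u r v : ℤ} (hu : u ≠ 0) (hr : r ≠ 0) (hv : v ≠ 0) :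
    Int.sign r * hilbertInfty (u * r) v = hilbertInfty u v * hilbertInfty r (-v) := by
  unfold hilbertInfty
  rcases lt_or_gt_of_ne hr with hr' | hr'
  · rw [Int.sign_eq_neg_one_of_neg hr']
    rcases lt_or_gt_of_ne hu with hu' | hu'
    · have h1 : 0 < u * r := mul_pos_of_neg_of_neg hu' hr'
      split_ifs <;> omega
    · have h1 : u * r < 0 := mul_neg_of_pos_of_neg hu' hr'
      split_ifs <;> omega
  · rw [Int.sign_eq_one_of_pos hr']
    rcases lt_or_gt_of_ne hu with hu' | hu'
    · have h1 : u * r < 0 := mul_neg_of_neg_of_pos hu' hr'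
      split_ifs <;> omega
    · have h1 : 0 < u * r := mul_pos hu' hr'
      split_ifs <;> omega


/-! ### Lemma 20.1, the two reciprocity steps of the proof -/

/-- `(x / |y|)` is congruence-invariant in `x` modulo `y`. [folklore] -/
theorem jacobiSym_natAbs_eq_of_dvd_sub {x x' y : ℤ} (h : y ∣ x - x') : J(x | y.natAbs) = J(x' | y.natAbs) := by
  refine jacobiSym.mod_left' ?_
  obtain ⟨c, hc⟩ := (Int.natAbs_dvd.mpr h : (y.natAbs : ℤ) ∣ x - x')
  have : x = x' + (y.natAbs : ℤ) * c := by rw [← hc]; ring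
  rw [this, Int.add_mul_emod_self_left]

/-- **Step `(r₁ / (u r₁ - v₁ s))` of the proof of Lemma 20.1**: for `m = u r₁ - v₁ s > 0` with
`4 ∣ v₁ s` and `(r₁, m) = 1`,
`(r₁ / m) = (-1)^{((r₁-1)/2)((m-1)/2)} (m / |r₁|) = sign(r₁) (-1)^{((r₁-1)/2)((u-1)/2)} (v₁ s / |r₁|)`
("by the reciprocity (17.6)"). [cite: FriedlanderIwaniecAnnals1998, Lemma 20.1 (proof)] -/
theorem jacobiSym_r₁_step {u r₁ v₁ s m : ℤ} (hu : Odd u) (hr₁ : Odd r₁) (hm0 : 0 < m)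
    (hm : m = u * r₁ - v₁ * s) (h4 : 4 ∣ v₁ * s) (hcop : Int.gcd r₁ m = 1) :
    J(r₁ | m.natAbs) = Int.sign r₁ * recipSign r₁ u * J(v₁ * s | r₁.natAbs) := by
  have hmodd : Odd m := by
    rw [hm, Int.odd_sub]
    exact iff_of_true (hu.mul hr₁) (by obtain ⟨c, hc⟩ := h4; exact ⟨2 * c, by rw [hc]; ring⟩)
  have hR : Odd r₁.natAbs := Int.natAbs_odd.mpr hr₁
  -- (17.6) for the pair `(r₁, m)`, `m > 0`
  have key := jacobiSym_natAbs_mul_jacobiSym_natAbs hr₁ hmodd hcop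
  rw [hilbertInfty_of_pos_right _ hm0, mul_one, mul_comm] at key
  -- `(m / |r₁|) = (-v₁ s / |r₁|) = χ₄(|r₁|) (v₁ s / |r₁|)`
  have hY : J(m | r₁.natAbs) = ZMod.χ₄ r₁.natAbs * J(v₁ * s | r₁.natAbs) := by
    rw [← jacobiSym.neg _ hR]
    refine jacobiSym_natAbs_eq_of_dvd_sub ⟨u, ?_⟩
    rw [hm]; ring
  have hY2 : J(m | r₁.natAbs) ^ 2 = 1 :=
    jacobiSym.sq_one (by rw [int_gcd_natAbs_cast, Int.gcd_comm]; exact hcop)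
  rw [eq_mul_of_sq_eq_one hY2 key, hY]
  -- the signs: `χ₄(|r₁|) (-1)^{e(r₁)e(m)} = sign(r₁) (-1)^{e(r₁)e(u)}`, using `m ≡ u r₁ (mod 4)`
  have hm4 : m % 4 = (u * r₁) % 4 := by rw [hm]; omega
  rw [recipSign_congr hm4, recipSign_mul_right _ hu hr₁, χ₄_nat_eq_ite hR]
  have hr0 : r₁ ≠ 0 := by rintro rfl; exact absurd hr₁ (by decide)
  unfold recipSign
  rcases lt_or_gt_of_ne hr0 with hneg | hpos
  · rw [Int.sign_eq_neg_one_of_neg hneg]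
    have h1 : (r₁.natAbs : ℤ) = -r₁ := by omega
    have h2 := emod_four_of_odd hr₁
    have h3 := emod_four_of_odd hu
    split_ifs <;> omega
  · rw [Int.sign_eq_one_of_pos hpos]
    have h1 : (r₁.natAbs : ℤ) = r₁ := by omega
    have h2 := emod_four_of_odd hr₁
    have h3 := emod_four_of_odd hu
    split_ifs <;> omega

/-- **Step `(v₁ / (u r₁ - v₁ s))` of the proof of Lemma 20.1**: for `m = u r₁ - v₁ s > 0`,
`v₁ = 2^α v'` (`α ≥ 1`, `v'` odd), `s` even and the coprimality conditions,
`(v₁ / m) = (u r, v)_∞ (-1)^{vs/4} (v₁ / |u r₁|)` ("writing `v₁ = 2^α v'` with `v'` odd, we compute by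
twice applying reciprocity that `(v₁/(ur₁ - v₁s)) = (ur, v)_∞ (v'/|ur₁|)(2^α/(ur₁ - v₁s))` … and we
evaluate the resulting Jacobi symbol for `2^α` by means of (20.7) getting
`(2^α/(ur₁ - v₁s))(2^α/|ur₁|) = (-1)^{vs/4}`"). Here the signs are those of `v₁` and `u r₁`.
[cite: FriedlanderIwaniecAnnals1998, Lemma 20.1 (proof)] -/
theorem jacobiSym_v₁_step {u r₁ v₁ s m V : ℤ} {α : ℕ} (hu : Odd u) (hr₁ : Odd r₁) (hV : Odd V)
    (hv₁ : v₁ = 2 ^ α * V) (hα : 1 ≤ α) (hs : Even s) (hm0 : 0 < m) (hm : m = u * r₁ - v₁ * s)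
    (hcopVm : Int.gcd V m = 1) (hcopVur : Int.gcd V (u * r₁) = 1)
    (hcop2 : Int.gcd v₁ (u * r₁) = 1) :
    J(v₁ | m.natAbs) = hilbertInfty (u * r₁) v₁ * (if (v₁ * s) % 8 = 4 then -1 else 1) *
      J(v₁ | (u * r₁).natAbs) := by
  have hur : Odd (u * r₁) := hu.mul hr₁
  have h4 : 4 ∣ v₁ * s := by
    obtain ⟨c, hc⟩ := hs
    obtain ⟨k, hk⟩ : ∃ k, α = k + 1 := ⟨α - 1, by omega⟩
    refine ⟨2 ^ k * V * c, ?_⟩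
    rw [hv₁, hc, hk, pow_succ]; ring
  have hmodd : Odd m := by
    rw [hm, Int.odd_sub]
    exact iff_of_true hur (by obtain ⟨c, hc⟩ := h4; exact ⟨2 * c, by rw [hc]; ring⟩)
  have hM : Odd m.natAbs := Int.natAbs_odd.mpr hmodd
  have hT : Odd (u * r₁).natAbs := Int.natAbs_odd.mpr hur
  have hm4 : m % 4 = (u * r₁) % 4 := by rw [hm]; omega
  -- (i) the odd part: `(V / m) = (V, u r₁)_∞ (V / |u r₁|)`
  have hVM : J(V | m.natAbs) = hilbertInfty V (u * r₁) * J(V | (u * r₁).natAbs) := by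
    have k1 := jacobiSym_natAbs_mul_jacobiSym_natAbs hV hmodd hcopVm
    rw [hilbertInfty_of_pos_right _ hm0, mul_one, mul_comm] at k1
    have k2 := jacobiSym_natAbs_mul_jacobiSym_natAbs hV hur hcopVur
    -- `(m / |V|) = (u r₁ / |V|)`
    have e1 : J(m | V.natAbs) = J(u * r₁ | V.natAbs) := by
      refine jacobiSym_natAbs_eq_of_dvd_sub ⟨-(2 ^ α * s), ?_⟩
      rw [hm, hv₁]; ring
    have sq1 : J(m | V.natAbs) ^ 2 = 1 :=
      jacobiSym.sq_one (by rw [int_gcd_natAbs_cast, Int.gcd_comm]; exact hcopVm)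
    have sq2 : J(V | (u * r₁).natAbs) ^ 2 = 1 :=
      jacobiSym.sq_one (by rw [int_gcd_natAbs_cast]; exact hcopVur)
    rw [eq_mul_of_sq_eq_one sq1 k1, e1, eq_mul_of_sq_eq_one sq2 k2, recipSign_congr hm4]
    have := recipSign_sq V (u * r₁)
    linear_combination (hilbertInfty V (u * r₁) * J(V | (u * r₁).natAbs)) * this
  -- (ii) the `2`-part: `(2 / m)(2 / |u r₁|) = (-1)^{v₁ s / 4}`
  have h2 : J(2 | m.natAbs) * J(2 | (u * r₁).natAbs) = if (v₁ * s) % 8 = 4 then -1 else 1 := by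
    rw [jacobiSym.at_two hM, jacobiSym.at_two hT, ZMod.χ₈_nat_eq_if_mod_eight,
      ZMod.χ₈_nat_eq_if_mod_eight]
    have e1 : (m.natAbs : ℤ) = u * r₁ - v₁ * s := by rw [← hm]; omega
    have e2 : ((u * r₁).natAbs : ℤ) = u * r₁ ∨ ((u * r₁).natAbs : ℤ) = -(u * r₁) := by omega
    have e3 : (u * r₁) % 2 = 1 := Int.odd_iff.mp hur
    have e4 : (v₁ * s) % 8 = 0 ∨ (v₁ * s) % 8 = 4 := by omega
    rcases e2 with e2 | e2 <;> split_ifs <;> omega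
  -- (iii) `((-1)^{v₁ s/4})^α = (-1)^{v₁ s / 4}` (if `v₁ s ≡ 4 (mod 8)` then `α = 1`)
  have hpow : (if (v₁ * s) % 8 = 4 then (-1 : ℤ) else 1) ^ α = if (v₁ * s) % 8 = 4 then -1 else 1 := by
    by_cases h : (v₁ * s) % 8 = 4
    · have hα1 : α = 1 := by
        by_contra hne
        obtain ⟨k, hk⟩ : ∃ k, α = k + 2 := ⟨α - 2, by omega⟩
        obtain ⟨c, hc⟩ := hs
        have : 8 ∣ v₁ * s := ⟨2 ^ k * V * c, by rw [hv₁, hc, hk, pow_add]; ring⟩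
        omega
      rw [if_pos h, hα1, pow_one]
    · rw [if_neg h, one_pow]
  -- (iv) assemble
  have hv₁M : J(v₁ | m.natAbs) = J(2 | m.natAbs) ^ α * J(V | m.natAbs) := by
    rw [hv₁, jacobiSym.mul_left, jacobiSym.pow_left]
  have hv₁T : J(v₁ | (u * r₁).natAbs) = J(2 | (u * r₁).natAbs) ^ α * J(V | (u * r₁).natAbs) := by
    rw [hv₁, jacobiSym.mul_left, jacobiSym.pow_left]
  have sqT : J(v₁ | (u * r₁).natAbs) ^ 2 = 1 :=
    jacobiSym.sq_one (by rw [int_gcd_natAbs_cast]; exact hcop2)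
  have sqVT : J(V | (u * r₁).natAbs) ^ 2 = 1 :=
    jacobiSym.sq_one (by rw [int_gcd_natAbs_cast]; exact hcopVur)
  have hprod : J(v₁ | (u * r₁).natAbs) * J(v₁ | m.natAbs) =
      hilbertInfty (u * r₁) v₁ * (if (v₁ * s) % 8 = 4 then -1 else 1) := by
    have hhil : hilbertInfty V (u * r₁) = hilbertInfty (u * r₁) v₁ := by
      rw [hilbertInfty_comm]
      refine hilbertInfty_congr Iff.rfl ?_
      rw [hv₁]
      have : (0 : ℤ) < 2 ^ α := by positivity
      exact ⟨fun h => mul_neg_of_pos_of_neg this h, fun h => neg_of_mul_neg_right h this.le⟩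
    calc J(v₁ | (u * r₁).natAbs) * J(v₁ | m.natAbs)
        = (J(2 | m.natAbs) * J(2 | (u * r₁).natAbs)) ^ α *
            (J(V | m.natAbs) * J(V | (u * r₁).natAbs)) := by rw [hv₁M, hv₁T]; ring
      _ = (if (v₁ * s) % 8 = 4 then -1 else 1) * (hilbertInfty V (u * r₁) * J(V | (u * r₁).natAbs) ^ 2) := by
            rw [h2, hpow, hVM]; ring
      _ = hilbertInfty (u * r₁) v₁ * (if (v₁ * s) % 8 = 4 then -1 else 1) := by
            rw [sqVT, hhil]; ring
  rw [eq_mul_of_sq_eq_one sqT hprod]; ring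


/-! ### Lemma 20.1: the Jacobi-symbol identity behind (20.4), case `Re wz > 0` -/

/-- `Int.gcd = 1` from `IsCoprime`. [folklore] -/
theorem int_gcd_eq_one_of_isCoprime {x y : ℤ} (h : IsCoprime x y) : Int.gcd x y = 1 :=
  Int.isCoprime_iff_gcd_eq_one.mp h

/-- **The core of (20.4) for `a = ur - vs > 0`**, with the data of the proof made explicit:
`r = ρ r₁`, `v = ρ v₁`, `(r₁, v₁) = 1`, `v₁ = 2^α v'` (`v'` odd, `α ≥ 1`), `(u, v) = (r, s) = 1`,
`u` odd, `s` even, `b = us + vr`, `q = u² + v²`. Then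
`(b / |a|) = (u,v)_∞ (r,-v)_∞ (-1)^{((u-1)/2)((r-1)/2) + vs/4} (v / |u|)(s / |r|)(a / q)`, which is
(20.4) stripped of the powers of `i` (see `jacobiKubota_mul`). The proof is the source's chain
`(b/a) = (us/ρ)((us+vr)/(ur₁ - v₁s)) = (us/ρ)(v₁r₁/(ur₁-v₁s))((u²+v²)/(ur₁-v₁s))`,
`((u²+v²)/(ur-vs)) = ((ur-vs)/(u²+v²))`, the two reciprocity steps `jacobiSym_r₁_step`,
`jacobiSym_v₁_step`, and `(us/ρ)(v₁/|u|)(s/|r₁|) = (u/ρ)(ρ/|u|)(v/|u|)(s/|r|)`.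
[cite: FriedlanderIwaniecAnnals1998, Lemma 20.1 (proof), (20.4)–(20.5)] -/
theorem jacobiSym_kubota_core_pos {u v r s a b r₁ v₁ V : ℤ} {q ρ α : ℕ}
    (hu : Odd u) (hr₁ : Odd r₁) (hV : Odd V) (hρ : Odd ρ)
    (hr : r = ρ * r₁) (hv : v = ρ * v₁) (hv₁ : v₁ = 2 ^ α * V) (hα : 1 ≤ α) (hs : Even s)
    (hcop1 : Int.gcd r₁ v₁ = 1) (hcopuv : Int.gcd u v = 1) (hcoprs : Int.gcd r s = 1)
    (ha : a = u * r - v * s) (hb : b = u * s + v * r) (ha0 : 0 < a) (hq : (q : ℤ) = u ^ 2 + v ^ 2) :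
    J(b | a.natAbs) = hilbertInfty u v * hilbertInfty r (-v) * recipSign u r *
      (if (v * s) % 8 = 4 then -1 else 1) * J(v | u.natAbs) * J(s | r.natAbs) * J(a | q) := by
  -- the flipped modulus `m = a / ρ`
  set m : ℤ := u * r₁ - v₁ * s with hm
  have ham : a = ρ * m := by rw [ha, hr, hv, hm]; ring
  have hρ0 : 0 < ρ := hρ.pos
  have hρ0' : (0 : ℤ) < ρ := by exact_mod_cast hρ0
  have hm0 : 0 < m := pos_of_mul_pos_right (ham ▸ ha0) hρ0'.le
  have hrodd : Odd r := by rw [hr]; exact_mod_cast ((Int.odd_coe_nat ρ).mpr hρ).mul hr₁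
  have hur : Odd (u * r₁) := hu.mul hr₁
  have h4 : 4 ∣ v₁ * s := by
    obtain ⟨c, hc⟩ := hs
    obtain ⟨k, hk⟩ : ∃ k, α = k + 1 := ⟨α - 1, by omega⟩
    exact ⟨2 ^ k * V * c, by rw [hv₁, hc, hk, pow_succ]; ring⟩
  have hmodd : Odd m := by
    rw [hm, Int.odd_sub]
    exact iff_of_true hur (by obtain ⟨c, hc⟩ := h4; exact ⟨2 * c, by rw [hc]; ring⟩)
  have hu0 : u ≠ 0 := by rintro rfl; exact absurd hu (by decide)
  have hr₁0 : r₁ ≠ 0 := by rintro rfl; exact absurd hr₁ (by decide)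
  have hV0 : V ≠ 0 := by rintro rfl; exact absurd hV (by decide)
  have hr0 : r ≠ 0 := by rintro rfl; exact absurd hrodd (by decide)
  have hv0 : v ≠ 0 := by
    rw [hv, hv₁]
    exact mul_ne_zero hρ0'.ne' (mul_ne_zero (pow_ne_zero _ two_ne_zero) hV0)
  have hM0 : m.natAbs ≠ 0 := by omega
  -- coprimality bookkeeping
  have cuv : IsCoprime u v := Int.isCoprime_iff_gcd_eq_one.mpr hcopuv
  have crs : IsCoprime r s := Int.isCoprime_iff_gcd_eq_one.mpr hcoprs
  have c11 : IsCoprime r₁ v₁ := Int.isCoprime_iff_gcd_eq_one.mpr hcop1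
  have g_v₁u : IsCoprime v₁ u := cuv.symm.of_isCoprime_of_dvd_left ⟨ρ, by rw [hv]; ring⟩
  have g_v₁ur : IsCoprime v₁ (u * r₁) := g_v₁u.mul_right c11.symm
  have g_v₁m : IsCoprime v₁ m := by
    have e : u * r₁ + v₁ * -s = m := by rw [hm]; ring
    exact e ▸ g_v₁ur.add_mul_left_right (-s)
  have g_Vm : IsCoprime V m := g_v₁m.of_isCoprime_of_dvd_left ⟨2 ^ α, by rw [hv₁]; ring⟩
  have g_Vur : IsCoprime V (u * r₁) := g_v₁ur.of_isCoprime_of_dvd_left ⟨2 ^ α, by rw [hv₁]; ring⟩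
  have g_r₁s : IsCoprime r₁ s := crs.of_isCoprime_of_dvd_left ⟨ρ, by rw [hr]; ring⟩
  have g_r₁m : IsCoprime r₁ m := by
    have e : -(v₁ * s) + r₁ * u = m := by rw [hm]; ring
    exact e ▸ ((c11.mul_right g_r₁s).neg_right).add_mul_left_right u
  have g_uρ : IsCoprime u (ρ : ℤ) := cuv.of_isCoprime_of_dvd_right ⟨v₁, hv⟩
  -- (F1) `(b / a) = (b / ρ)(b / m)`
  have hA : a.natAbs = ρ * m.natAbs := by rw [ham, Int.natAbs_mul, Int.natAbs_natCast]
  have F1 : J(b | a.natAbs) = J(b | ρ) * J(b | m.natAbs) := by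
    rw [hA]; exact jacobiSym.mul_right' b hρ0.ne' hM0
  -- (F2) `(b / ρ) = (us / ρ)`
  have F2 : J(b | ρ) = J(u * s | ρ) := by
    refine jacobiSym.mod_left' ?_
    have : b = u * s + (ρ : ℤ) * (v₁ * r) := by rw [hb, hv]; ring
    rw [this, Int.add_mul_emod_self_left]
  -- (F3) `(b / m) = (v₁ / m)(q / m)(r₁ / m)` (from `v₁ b ≡ q r₁ (mod m)`)
  have F3 : J(b | m.natAbs) = J(v₁ | m.natAbs) * (J((q : ℤ) | m.natAbs) * J(r₁ | m.natAbs)) := by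
    have e : J(v₁ | m.natAbs) * J(b | m.natAbs) = J((q : ℤ) * r₁ | m.natAbs) := by
      rw [← jacobiSym.mul_left]
      refine jacobiSym_natAbs_eq_of_dvd_sub ⟨-u, ?_⟩
      rw [hb, hq, hr, hv, hm]; ring
    rw [jacobiSym.mul_left] at e
    exact eq_mul_of_sq_eq_one (jacobiSym.sq_one (by rw [int_gcd_natAbs_cast]; exact int_gcd_eq_one_of_isCoprime g_v₁m)) e
  -- (F4) `(q / m) = (a / q)`
  have hq4 : q % 4 = 1 := by
    obtain ⟨k, hk⟩ := hu
    obtain ⟨t, ht⟩ : ∃ t : ℤ, (q : ℤ) = 4 * t + 1 :=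
      ⟨k ^ 2 + k + (ρ * 2 ^ (α - 1) * V) ^ 2, by
        obtain ⟨j, hj⟩ : ∃ j, α = j + 1 := ⟨α - 1, by omega⟩
        rw [hq, hk, hv, hv₁, hj, pow_succ]; simp; ring⟩
    omega
  have F4 : J((q : ℤ) | m.natAbs) = J(a | q) := by
    have e1 : J((q : ℤ) | a.natAbs) = J((q : ℤ) | ρ) * J((q : ℤ) | m.natAbs) := by
      rw [hA]; exact jacobiSym.mul_right' _ hρ0.ne' hM0
    have e2 : J((q : ℤ) | ρ) = 1 := by
      have : J((q : ℤ) | ρ) = J(u ^ 2 | ρ) := by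
        refine jacobiSym.mod_left' ?_
        have : (q : ℤ) = u ^ 2 + (ρ : ℤ) * (ρ * v₁ ^ 2) := by rw [hq, hv]; ring
        rw [this, Int.add_mul_emod_self_left]
      rw [this]
      exact jacobiSym.sq_one' (int_gcd_eq_one_of_isCoprime g_uρ)
    have e3 : J((q : ℤ) | a.natAbs) = J((a.natAbs : ℤ) | q) :=
      jacobiSym.quadratic_reciprocity_one_mod_four hq4 (Int.natAbs_odd.mpr (by
        rw [ham]; exact ((Int.odd_coe_nat ρ).mpr hρ).mul hmodd))
    rw [e2, one_mul] at e1
    rw [← e1, e3, Int.natAbs_of_nonneg ha0.le]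
  -- (F5) and (F6)
  have F5 := jacobiSym_r₁_step (v₁ := v₁) (s := s) hu hr₁ hm0 hm h4 (int_gcd_eq_one_of_isCoprime g_r₁m)
  have F6 := jacobiSym_v₁_step hu hr₁ hV hv₁ hα hs hm0 hm (int_gcd_eq_one_of_isCoprime g_Vm)
    (int_gcd_eq_one_of_isCoprime g_Vur) (int_gcd_eq_one_of_isCoprime g_v₁ur)
  -- (F7) splitting the remaining symbols into the atoms `(ρ/|u|)`, `(v₁/|u|)`, `(v₁/|r₁|)`, `(s/ρ)`, `(s/|r₁|)`
  have hT : (u * r₁).natAbs = u.natAbs * r₁.natAbs := Int.natAbs_mul u r₁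
  have hR : r.natAbs = ρ * r₁.natAbs := by rw [hr, Int.natAbs_mul, Int.natAbs_natCast]
  have s1 : J(v₁ | (u * r₁).natAbs) = J(v₁ | u.natAbs) * J(v₁ | r₁.natAbs) := by
    rw [hT]; exact jacobiSym.mul_right' _ (by omega) (by omega)
  have s2 : J(v₁ * s | r₁.natAbs) = J(v₁ | r₁.natAbs) * J(s | r₁.natAbs) := jacobiSym.mul_left _ _ _
  have s3 : J(u * s | ρ) = J(u | ρ) * J(s | ρ) := jacobiSym.mul_left _ _ _
  have s4 : J(u | ρ) = recipSign u ρ * J((ρ : ℤ) | u.natAbs) := by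
    have k := jacobiSym_natAbs_mul_jacobiSym_natAbs hu ((Int.odd_coe_nat ρ).mpr hρ) (int_gcd_eq_one_of_isCoprime g_uρ)
    rw [hilbertInfty_of_pos_right _ hρ0', mul_one, Int.natAbs_natCast, mul_comm] at k
    rw [eq_mul_of_sq_eq_one (jacobiSym.sq_one ?_) k, mul_comm]
    rw [int_gcd_natAbs_cast, Int.gcd_comm]; exact int_gcd_eq_one_of_isCoprime g_uρ
  have s5 : J(v | u.natAbs) = J((ρ : ℤ) | u.natAbs) * J(v₁ | u.natAbs) := by
    rw [hv]; exact jacobiSym.mul_left _ _ _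
  have s6 : J(s | r.natAbs) = J(s | ρ) * J(s | r₁.natAbs) := by
    rw [hR]; exact jacobiSym.mul_right' _ hρ0.ne' (by omega)
  have hQ : J(v₁ | r₁.natAbs) ^ 2 = 1 :=
    jacobiSym.sq_one (by rw [int_gcd_natAbs_cast, Int.gcd_comm]; exact hcop1)
  -- the signs
  have hD : (if (v₁ * s) % 8 = 4 then (-1 : ℤ) else 1) = if (v * s) % 8 = 4 then -1 else 1 := by
    obtain ⟨t, ht⟩ := h4
    obtain ⟨c, hc⟩ := hρ
    obtain ⟨p, hp⟩ : ∃ p : ℤ, v * s = 8 * p + 4 * t := ⟨c * t, by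
      have : v * s = (ρ : ℤ) * (v₁ * s) := by rw [hv]; ring
      rw [this, ht, hc]; push_cast; ring⟩
    have : (v * s) % 8 = (v₁ * s) % 8 := by omega
    rw [this]
  have hrs : recipSign r₁ u * recipSign u ρ = recipSign u r := by
    rw [recipSign_comm r₁ u, ← recipSign_mul_right u hr₁ ((Int.odd_coe_nat ρ).mpr hρ), hr, mul_comm (ρ : ℤ) r₁]
  have hsig : Int.sign r₁ * hilbertInfty (u * r₁) v₁ = hilbertInfty u v * hilbertInfty r (-v) := by
    have e1 : Int.sign r₁ = Int.sign r := by
      rw [hr, Int.sign_mul, Int.sign_eq_one_of_pos hρ0', one_mul]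
    have e2 : hilbertInfty (u * r₁) v₁ = hilbertInfty (u * r) v := by
      refine hilbertInfty_congr ?_ ?_
      · rw [hr, show u * (ρ * r₁) = ρ * (u * r₁) by ring]
        exact ⟨fun h => mul_neg_of_pos_of_neg hρ0' h, fun h => neg_of_mul_neg_right h hρ0'.le⟩
      · rw [hv]
        exact ⟨fun h => mul_neg_of_pos_of_neg hρ0' h, fun h => neg_of_mul_neg_right h hρ0'.le⟩
    rw [e1, e2]
    exact sign_mul_hilbertInfty_mul hu0 hr0 hv0
  -- assembly
  calc J(b | a.natAbs)
      = (recipSign u ρ * J((ρ : ℤ) | u.natAbs) * J(s | ρ)) *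
          (hilbertInfty (u * r₁) v₁ * (if (v₁ * s) % 8 = 4 then -1 else 1) *
            (J(v₁ | u.natAbs) * J(v₁ | r₁.natAbs))) *
          (J(a | q) * (Int.sign r₁ * recipSign r₁ u * (J(v₁ | r₁.natAbs) * J(s | r₁.natAbs)))) := by
        rw [F1, F2, F3, F4, F5, F6, s1, s2, s3, s4]; ring
    _ = (Int.sign r₁ * hilbertInfty (u * r₁) v₁) * (recipSign r₁ u * recipSign u ρ) *
          (if (v₁ * s) % 8 = 4 then -1 else 1) * J(v₁ | r₁.natAbs) ^ 2 *
          (J((ρ : ℤ) | u.natAbs) * J(v₁ | u.natAbs)) * (J(s | ρ) * J(s | r₁.natAbs)) * J(a | q) := by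
        ring
    _ = hilbertInfty u v * hilbertInfty r (-v) * recipSign u r *
          (if (v * s) % 8 = 4 then -1 else 1) * J(v | u.natAbs) * J(s | r.natAbs) * J(a | q) := by
        rw [hsig, hrs, hD, hQ, s5, s6]; ring


/-! ### Lemma 20.1: the Jacobi-symbol identity (20.4) without the powers of `i` -/

/-- The sign `ε = ε(w, z)` of Lemma 20.1, (20.5)–(20.6): for `w = u + iv`, `z = r + is`,
`ε = (u, v)_∞ (r, -v)_∞` if `ur > vs` and `ε = (u, v)_∞ (-r, v)_∞` if `ur < vs`.
[cite: FriedlanderIwaniecAnnals1998, (20.5)–(20.6)] -/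
def kubotaEps (u v r s : ℤ) : ℤ :=
  if 0 < u * r - v * s then hilbertInfty u v * hilbertInfty r (-v)
  else hilbertInfty u v * hilbertInfty (-r) v

/-- Unfolding `kubotaEps`. [cite: FriedlanderIwaniecAnnals1998, (20.5)–(20.6)] -/
theorem kubotaEps_def (u v r s : ℤ) : kubotaEps u v r s =
    if 0 < u * r - v * s then hilbertInfty u v * hilbertInfty r (-v)
    else hilbertInfty u v * hilbertInfty (-r) v := rfl

/-- `kubotaEps` takes the values `±1`. [cite: FriedlanderIwaniecAnnals1998, (20.5)–(20.6)] -/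
theorem kubotaEps_sq (u v r s : ℤ) : kubotaEps u v r s ^ 2 = 1 := by
  unfold kubotaEps hilbertInfty; split_ifs <;> norm_num

/-- The sign factor `(-1)^{((u-1)/2)((r-1)/2) + vs/4}` relating `i^{(a-1)/2}` to
`i^{(u-1)/2 + (r-1)/2}` in (20.4) (see `jacobiKubota_mul`): as a function of `u, r (mod 4)` and
`vs (mod 8)`. [cite: FriedlanderIwaniecAnnals1998, Lemma 20.1 (proof, the parity `ν`)] -/
def kubotaSign (u v r s : ℤ) : ℤ := recipSign u r * (if (v * s) % 8 = 4 then -1 else 1)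

/-- Unfolding `kubotaSign`. [cite: FriedlanderIwaniecAnnals1998, Lemma 20.1 (proof)] -/
theorem kubotaSign_def (u v r s : ℤ) :
    kubotaSign u v r s = recipSign u r * (if (v * s) % 8 = 4 then -1 else 1) := rfl

/-- **(20.4) for `ur > vs`, Jacobi-symbol part**: for `u` odd, `v ≠ 0` even, `(u, v) = 1`, `r` odd,
`s` even, `(r, s) = 1` and `a = ur - vs > 0`, `b = us + vr`, `q = u² + v²`:
`(b / |a|) = (u,v)_∞ (r,-v)_∞ (-1)^{((u-1)/2)((r-1)/2) + vs/4} (v/|u|)(s/|r|)(a/q)`.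
[cite: FriedlanderIwaniecAnnals1998, Lemma 20.1 (proof), (20.4)–(20.5)] -/
theorem jacobiSym_kubota_pos {u v r s : ℤ} {q : ℕ} (hu : Odd u) (hv : Even v) (hv0 : v ≠ 0)
    (hr : Odd r) (hs : Even s) (hcopuv : Int.gcd u v = 1) (hcoprs : Int.gcd r s = 1)
    (ha0 : 0 < u * r - v * s) (hq : (q : ℤ) = u ^ 2 + v ^ 2) :
    J(u * s + v * r | (u * r - v * s).natAbs) = hilbertInfty u v * hilbertInfty r (-v) *
      kubotaSign u v r s * J(v | u.natAbs) * J(s | r.natAbs) * J(u * r - v * s | q) := by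
  -- `ρ = (r, v)`, `r = ρ r₁`, `v = ρ v₁`
  have hr0 : r ≠ 0 := by rintro rfl; exact absurd hr (by decide)
  obtain ⟨ρ, hρ⟩ : ∃ ρ : ℕ, Int.gcd r v = ρ := ⟨_, rfl⟩
  have hρ0 : 0 < ρ := hρ ▸ Int.gcd_pos_of_ne_zero_left v hr0
  have hρ0' : (ρ : ℤ) ≠ 0 := by exact_mod_cast hρ0.ne'
  obtain ⟨r₁, hrr⟩ : (ρ : ℤ) ∣ r := hρ ▸ Int.gcd_dvd_left r v
  obtain ⟨v₁, hvv⟩ : (ρ : ℤ) ∣ v := hρ ▸ Int.gcd_dvd_right r v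
  have hcop1 : Int.gcd r₁ v₁ = 1 := by
    have h := Int.gcd_div_gcd_div_gcd (hρ ▸ hρ0 : 0 < Int.gcd r v)
    rw [hρ] at h
    have e1 : r / (ρ : ℤ) = r₁ := by rw [hrr, Int.mul_ediv_cancel_left _ hρ0']
    have e2 : v / (ρ : ℤ) = v₁ := by rw [hvv, Int.mul_ediv_cancel_left _ hρ0']
    rwa [e1, e2] at h
  have hρodd : Odd ρ := by
    rcases Nat.even_or_odd ρ with h | h
    · exfalso
      obtain ⟨c, hc⟩ := h
      have : Even r := ⟨c * r₁, by rw [hrr, hc]; push_cast; ring⟩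
      exact (Int.not_even_iff_odd.mpr hr) this
    · exact h
  have hr₁odd : Odd r₁ := by
    have h := hr; rw [hrr, Int.odd_mul] at h; exact h.2
  have hv₁even : Even v₁ := by
    have h := hv
    rw [hvv, Int.even_mul] at h
    rcases h with h | h
    · exact absurd ((Int.odd_coe_nat ρ).mpr hρodd) (Int.not_odd_iff_even.mpr h)
    · exact h
  have hv₁0 : v₁ ≠ 0 := by rintro h; rw [h, mul_zero] at hvv; exact hv0 hvv
  -- `v₁ = 2^α V`, `V` odd, `α ≥ 1`
  obtain ⟨α, W, hWodd, hW⟩ := Nat.exists_eq_two_pow_mul_odd (Int.natAbs_ne_zero.mpr hv₁0)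
  obtain ⟨V, hVodd, hV⟩ : ∃ V : ℤ, Odd V ∧ v₁ = 2 ^ α * V := by
    rcases Int.natAbs_eq v₁ with h | h
    · exact ⟨W, (Int.odd_coe_nat W).mpr hWodd, by rw [h, hW]; push_cast; ring⟩
    · exact ⟨-W, ((Int.odd_coe_nat W).mpr hWodd).neg, by rw [h, hW]; push_cast; ring⟩
  have hα : 1 ≤ α := by
    by_contra hlt
    have hα0 : α = 0 := by omega
    rw [hα0, pow_zero, one_mul] at hV
    exact (Int.not_odd_iff_even.mpr hv₁even) (hV ▸ hVodd)
  have h := jacobiSym_kubota_core_pos (q := q) hu hr₁odd hVodd hρodd hrr hvv hV hα hs hcop1 hcopuv hcoprs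
    rfl rfl ha0 hq
  rw [h, kubotaSign_def]; ring

/-- `χ₄` of an odd natural number squares to `1`. [folklore] -/
theorem χ₄_nat_mul_self {n : ℕ} (hn : Odd n) : (ZMod.χ₄ n : ℤ) * ZMod.χ₄ n = 1 := by
  rw [χ₄_nat_eq_ite hn]; split_ifs <;> norm_num

/-- `χ₄(|r|) = sign(r) χ₄(r mod 4)` for odd `r`. [folklore] -/
theorem χ₄_natAbs_eq_sign_mul {r : ℤ} (hr : Odd r) :
    (ZMod.χ₄ r.natAbs : ℤ) = Int.sign r * (if r % 4 = 1 then 1 else -1) := by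
  rw [χ₄_nat_eq_ite (Int.natAbs_odd.mpr hr)]
  have hr0 : r ≠ 0 := by rintro rfl; exact absurd hr (by decide)
  have h2 := emod_four_of_odd hr
  rcases lt_or_gt_of_ne hr0 with h | h
  · rw [Int.sign_eq_neg_one_of_neg h]
    have : (r.natAbs : ℤ) = -r := by omega
    split_ifs <;> omega
  · rw [Int.sign_eq_one_of_pos h]
    have : (r.natAbs : ℤ) = r := by omega
    split_ifs <;> omega

/-- Sign bookkeeping for the case `ur < vs` of Lemma 20.1: `(-1)^{e(-u)e(r)} χ₄(r mod 4) = (-1)^{e(u)e(r)}`.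
[cite: FriedlanderIwaniecAnnals1998, Lemma 20.1 (proof)] -/
theorem recipSign_neg_left_mul {u r : ℤ} (hu : Odd u) (hr : Odd r) :
    recipSign (-u) r * (if r % 4 = 1 then 1 else -1) = recipSign u r := by
  unfold recipSign
  have h1 := emod_four_of_odd hu
  have h2 := emod_four_of_odd hr
  split_ifs <;> omega

/-- Sign bookkeeping for the case `ur < vs` of Lemma 20.1:
`(-u, v)_∞ (r, -v)_∞ sign(r) = (u, v)_∞ (-r, v)_∞` for `u, r, v ≠ 0`.
[cite: FriedlanderIwaniecAnnals1998, Lemma 20.1 (proof), (20.10)–(20.11)] -/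
theorem hilbertInfty_neg_flip {u r v : ℤ} (hu : u ≠ 0) (hr : r ≠ 0) (hv : v ≠ 0) :
    hilbertInfty (-u) v * hilbertInfty r (-v) * Int.sign r = hilbertInfty u v * hilbertInfty (-r) v := by
  unfold hilbertInfty
  rcases lt_or_gt_of_ne hr with hr' | hr'
  · rw [Int.sign_eq_neg_one_of_neg hr']
    rcases lt_or_gt_of_ne hu with hu' | hu' <;> rcases lt_or_gt_of_ne hv with hv' | hv' <;>
      · split_ifs <;> omega
  · rw [Int.sign_eq_one_of_pos hr']
    rcases lt_or_gt_of_ne hu with hu' | hu' <;> rcases lt_or_gt_of_ne hv with hv' | hv' <;>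
      · split_ifs <;> omega

/-- **(20.4) for `ur < vs`, Jacobi-symbol part**: same as `jacobiSym_kubota_pos` with the sign
`(u,v)_∞ (-r, v)_∞` of (20.6). (The source flips `(r, s) ↦ (-r, -s)`; we flip `(u, s) ↦ (-u, -s)`,
which also turns `a` into `-a > 0` but leaves `b` and `|a|` unchanged, and then only the signs
`(-u,v)_∞ (r,-v)_∞ (-1)^{e(-u)e(r)} (-s/|r|)` have to be compared with `(u,v)_∞(-r,v)_∞ (-1)^{e(u)e(r)} (s/|r|)`.)
[cite: FriedlanderIwaniecAnnals1998, Lemma 20.1 (proof), (20.4), (20.6)] -/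
theorem jacobiSym_kubota_neg {u v r s : ℤ} {q : ℕ} (hu : Odd u) (hv : Even v) (hv0 : v ≠ 0)
    (hr : Odd r) (hs : Even s) (hcopuv : Int.gcd u v = 1) (hcoprs : Int.gcd r s = 1)
    (ha0 : u * r - v * s < 0) (hq : (q : ℤ) = u ^ 2 + v ^ 2) :
    J(u * s + v * r | (u * r - v * s).natAbs) = hilbertInfty u v * hilbertInfty (-r) v *
      kubotaSign u v r s * J(v | u.natAbs) * J(s | r.natAbs) * J(u * r - v * s | q) := by
  -- apply the positive case to `(-u, v, r, -s)`
  have ha0' : 0 < (-u) * r - v * (-s) := by linarith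
  have h := jacobiSym_kubota_pos (q := q) hu.neg hv hv0 hr hs.neg (by rwa [Int.neg_gcd])
    (by rwa [Int.gcd_neg]) ha0' (by rw [hq]; ring)
  have hR : Odd r.natAbs := Int.natAbs_odd.mpr hr
  have hq4 : q % 4 = 1 := by
    obtain ⟨k, hk⟩ := hu
    obtain ⟨c, hc⟩ := hv
    obtain ⟨t, ht⟩ : ∃ t : ℤ, (q : ℤ) = 4 * t + 1 := ⟨k ^ 2 + k + c ^ 2, by rw [hq, hk, hc]; ring⟩
    omega
  have hqodd : Odd q := Nat.odd_iff.mpr (by omega)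
  have hu0 : u ≠ 0 := by rintro rfl; exact absurd hu (by decide)
  have hr0 : r ≠ 0 := by rintro rfl; exact absurd hr (by decide)
  -- rewrite the flipped identity in terms of the original symbols
  have e1 : ((-u) * r - v * (-s)).natAbs = (u * r - v * s).natAbs := by
    rw [show (-u) * r - v * (-s) = -(u * r - v * s) by ring, Int.natAbs_neg]
  have e2 : (-u) * (-s) + v * r = u * s + v * r := by ring
  have e3 : (-u) * r - v * (-s) = -(u * r - v * s) := by ring
  have e4 : kubotaSign (-u) v r (-s) = recipSign (-u) r * (if (v * s) % 8 = 4 then -1 else 1) := by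
    rw [kubotaSign_def, show v * -s = -(v * s) by ring]
    have : (-(v * s)) % 8 = 4 ↔ (v * s) % 8 = 4 := by omega
    simp only [this]
  rw [e1, e2, e3, e4, Int.natAbs_neg, jacobiSym.neg _ hR, jacobiSym.neg _ hqodd,
    ZMod.χ₄_nat_one_mod_four hq4, one_mul, χ₄_natAbs_eq_sign_mul hr] at h
  have P1 := recipSign_neg_left_mul hu hr
  have P2 := hilbertInfty_neg_flip hu0 hr0 hv0
  calc J(u * s + v * r | (u * r - v * s).natAbs)
      = (hilbertInfty (-u) v * hilbertInfty r (-v) * Int.sign r) *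
          (recipSign (-u) r * (if r % 4 = 1 then 1 else -1)) * (if (v * s) % 8 = 4 then -1 else 1) *
          J(v | u.natAbs) * J(s | r.natAbs) * J(u * r - v * s | q) := by rw [h]; ring
    _ = hilbertInfty u v * hilbertInfty (-r) v * kubotaSign u v r s * J(v | u.natAbs) * J(s | r.natAbs) *
          J(u * r - v * s | q) := by rw [P1, P2, kubotaSign_def]; ring

/-- **(20.4), Jacobi-symbol part, both cases**: for `u` odd, `v ≠ 0` even, `(u, v) = 1`, `r` odd,
`s` even: `(b / |a|) = ε (-1)^{((u-1)/2)((r-1)/2) + vs/4} (v/|u|)(s/|r|)(a/q)` with `a = ur - vs`,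
`b = us + vr`, `q = u² + v²` and `ε = kubotaEps u v r s` ((20.5)–(20.6)). If `(r, s) ≠ 1` both sides
vanish. [cite: FriedlanderIwaniecAnnals1998, Lemma 20.1, (20.4)–(20.6)] -/
theorem jacobiSym_kubota {u v r s : ℤ} {q : ℕ} (hu : Odd u) (hv : Even v) (hv0 : v ≠ 0)
    (hr : Odd r) (hs : Even s) (hcopuv : Int.gcd u v = 1) (hq : (q : ℤ) = u ^ 2 + v ^ 2) :
    J(u * s + v * r | (u * r - v * s).natAbs) =
      kubotaEps u v r s * kubotaSign u v r s * J(v | u.natAbs) * J(s | r.natAbs) * J(u * r - v * s | q) := by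
  have hane : u * r - v * s ≠ 0 := by
    intro h
    have : Odd (u * r - v * s) := by rw [Int.odd_sub]; exact iff_of_true (hu.mul hr) (hv.mul_right s)
    rw [h] at this; exact absurd this (by decide)
  by_cases hcoprs : Int.gcd r s = 1
  · unfold kubotaEps
    rcases lt_or_gt_of_ne hane with hlt | hgt
    · rw [if_neg (not_lt.mpr hlt.le)]
      exact jacobiSym_kubota_neg hu hv hv0 hr hs hcopuv hcoprs hlt hq
    · rw [if_pos hgt]
      exact jacobiSym_kubota_pos hu hv hv0 hr hs hcopuv hcoprs hgt hq
  · -- `(r, s) = g > 1`: both sides vanish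
    obtain ⟨p, hp, hpg⟩ := Nat.exists_prime_and_dvd hcoprs
    have hr0 : r ≠ 0 := by rintro rfl; exact absurd hr (by decide)
    have hpr : (p : ℤ) ∣ r := (Int.natCast_dvd_natCast.mpr hpg).trans (Int.gcd_dvd_left _ _)
    have hps : (p : ℤ) ∣ s := (Int.natCast_dvd_natCast.mpr hpg).trans (Int.gcd_dvd_right _ _)
    have h1 : J(s | r.natAbs) = 0 := by
      refine jacobiSym_eq_zero_of_prime_dvd hp (by omega) hps ?_
      exact Int.natAbs_dvd.mpr hpr |> fun h => by exact_mod_cast Int.dvd_natAbs.mpr hpr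
    have h2 : J(u * s + v * r | (u * r - v * s).natAbs) = 0 := by
      refine jacobiSym_eq_zero_of_prime_dvd hp (by omega) ((hps.mul_left u).add (hpr.mul_left v)) ?_
      have : (p : ℤ) ∣ u * r - v * s := (hpr.mul_left u).sub (hps.mul_left v)
      exact_mod_cast Int.dvd_natAbs.mpr this
    rw [h1, h2]; ring


/-! ### The Jacobi–Kubota symbol `[z]` (20.1) and Lemma 20.1 -/

/-- **The Jacobi–Kubota symbol** (20.1): for `z = r + is ≡ 1 (mod 2)` (i.e. `r` odd, `s` even),
`[z] = i^{(r-1)/2} (s / |r|)` (Jacobi symbol; "Note that `[z]` vanishes if `z` is not primitive. Here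
the factor `i^{(r-1)/2}` is attached since it simplifies forthcoming relations"). The definition makes
sense for every `z`; it is used only for `z ≡ 1 (mod 2)`. [cite: FriedlanderIwaniecAnnals1998, (20.1)] -/
def jacobiKubota (z : ℤ[i]) : ℂ := Complex.I ^ ((z.re - 1) / 2) * (J(z.im | z.re.natAbs) : ℂ)

/-- Unfolding `jacobiKubota`. [cite: FriedlanderIwaniecAnnals1998, (20.1)] -/
theorem jacobiKubota_def (z : ℤ[i]) :
    jacobiKubota z = Complex.I ^ ((z.re - 1) / 2) * (J(z.im | z.re.natAbs) : ℂ) := rfl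

/-- `[1] = 1`. [cite: FriedlanderIwaniecAnnals1998, (20.1)] -/
theorem jacobiKubota_one : jacobiKubota 1 = 1 := by
  rw [jacobiKubota_def]; simp [jacobiSym.one_right]

/-- `[z] = 0` if `z = r + is` with `r ≠ 0` is not primitive ("`[z]` vanishes if `z` is not
primitive"; for `r` odd the hypothesis `r ≠ 0` is automatic).
[cite: FriedlanderIwaniecAnnals1998, §20 after (20.1)] -/
theorem jacobiKubota_eq_zero_of_not_isPrimitive {z : ℤ[i]} (hz : ¬ IsPrimitive z) (hr : z.re ≠ 0) :
    jacobiKubota z = 0 := by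
  have hg : Int.gcd z.re z.im ≠ 1 := hz
  obtain ⟨p, hp, hpg⟩ := Nat.exists_prime_and_dvd hg
  have hpr : (p : ℤ) ∣ z.re := (Int.natCast_dvd_natCast.mpr hpg).trans (Int.gcd_dvd_left _ _)
  have hps : (p : ℤ) ∣ z.im := (Int.natCast_dvd_natCast.mpr hpg).trans (Int.gcd_dvd_right _ _)
  rw [jacobiKubota_def, jacobiSym_eq_zero_of_prime_dvd hp (by omega) hps
    (by exact_mod_cast Int.dvd_natAbs.mpr hpr)]
  simp

/-- `(-1)^{m-n} = (-1)^m (-1)^n` for integer exponents. [folklore] -/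
theorem neg_one_zpow_sub (m n : ℤ) : (-1 : ℂ) ^ (m - n) = (-1) ^ m * (-1) ^ n := by
  rw [zpow_sub₀ (by norm_num : (-1 : ℂ) ≠ 0), div_eq_mul_inv]
  congr 1
  refine inv_eq_of_mul_eq_one_right ?_
  rw [← zpow_add₀ (by norm_num : (-1 : ℂ) ≠ 0), ← two_mul, zpow_mul, zpow_two]
  norm_num

/-- **The powers of `i` in (20.4)**: for `u`, `r` odd, `4 ∣ vs` and `a = ur - vs`,
`i^{(u-1)/2} i^{(r-1)/2} = i^{(a-1)/2} (-1)^{((u-1)/2)((r-1)/2) + vs/4}` (the parity `ν` at the end of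
the proof of Lemma 20.1: "`ν ≡ -((r-1)/2)((u-1)/2) + vs/4`").
[cite: FriedlanderIwaniecAnnals1998, Lemma 20.1 (proof, the parity `ν`)] -/
theorem I_zpow_mul_I_zpow_eq {u v r s : ℤ} (hu : Odd u) (hr : Odd r) (h4 : 4 ∣ v * s) :
    Complex.I ^ ((u - 1) / 2) * Complex.I ^ ((r - 1) / 2) =
      Complex.I ^ ((u * r - v * s - 1) / 2) * (kubotaSign u v r s : ℂ) := by
  obtain ⟨k, hk⟩ := hu
  obtain ⟨l, hl⟩ := hr
  obtain ⟨t, ht⟩ := h4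
  have e1 : (u - 1) / 2 = k := by omega
  have e2 : (r - 1) / 2 = l := by omega
  obtain ⟨m, hm, hm'⟩ : ∃ m : ℤ, u * r - v * s = 2 * m + 1 ∧ m = 2 * k * l + k + l - 2 * t :=
    ⟨2 * k * l + k + l - 2 * t, by rw [hk, hl, ht]; ring, rfl⟩
  have e3 : (u * r - v * s - 1) / 2 = m := by omega
  have e4 : k + l = m + 2 * (t - k * l) := by rw [hm']; ring
  rw [e1, e2, e3, ← zpow_add₀ Complex.I_ne_zero, e4, zpow_add₀ Complex.I_ne_zero, zpow_mul, zpow_two,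
    Complex.I_mul_I, neg_one_zpow_sub]
  congr 1
  -- `(-1)^t (-1)^{kl} = kubotaSign u v r s = (-1)^{e(u)e(r)} (-1)^{vs/4}`
  rw [kubotaSign_def, Int.cast_mul, mul_comm]
  congr 1
  · -- `(-1)^{kl} = recipSign u r`
    unfold recipSign
    rcases Int.even_or_odd (k * l) with h | h
    · rw [h.neg_one_zpow]
      have : ¬ (u % 4 = 3 ∧ r % 4 = 3) := by
        rw [Int.even_mul] at h
        rcases h with h | h
        · have := Int.even_iff.mp h; omega
        · have := Int.even_iff.mp h; omega
      rw [if_neg this]; simp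
    · rw [h.neg_one_zpow]
      have : u % 4 = 3 ∧ r % 4 = 3 := by
        obtain ⟨h1, h2⟩ := Int.odd_mul.mp h
        have := Int.odd_iff.mp h1; have := Int.odd_iff.mp h2; omega
      rw [if_pos this]; simp
  · -- `(-1)^t = (-1)^{vs/4}`
    rcases Int.even_or_odd t with h | h
    · rw [h.neg_one_zpow]
      have : ¬ (v * s) % 8 = 4 := by have := Int.even_iff.mp h; omega
      rw [if_neg this]; simp
    · rw [h.neg_one_zpow]
      have : (v * s) % 8 = 4 := by have := Int.odd_iff.mp h; omega
      rw [if_pos this]; simp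

/-- A primary primitive `w` with `im w = 0` is `w = 1`. [folklore] -/
theorem eq_one_of_isPrimary_of_im_eq_zero {w : ℤ[i]} (hw : IsPrimary w) (hw' : IsPrimitive w)
    (hv : w.im = 0) : w = 1 := by
  have hg : Int.gcd w.re w.im = 1 := hw'
  rw [hv, Int.gcd_zero_right] at hg
  have habs : (w.re.natAbs : ℤ) = 1 := by exact_mod_cast hg
  have hcases := Int.natAbs_eq w.re
  have hre : w.re = 1 := by
    rcases hw with ⟨h1, h2⟩ | ⟨h1, h2⟩ <;> omega
  exact Zsqrtd.ext hre hv

/-- **Lemma 20.1** (Friedlander–Iwaniec): if `w` is primary primitive and `z ≡ 1 (mod 2)` then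
`[wz] = ε [w] [z] (z / w)` with `ε = ±1` depending only on the quadrants in which `w, z, wz` are
located; precisely, for `w = u + iv`, `z = r + is`, `ε = (u,v)_∞ (r,-v)_∞` if `ur > vs` and
`ε = (u,v)_∞ (-r,v)_∞` if `ur < vs` ((20.3)–(20.6); here `ε = kubotaEps u v r s`, `[·] = jacobiKubota`,
`(z/w) = dirichletSym z w`). [cite: FriedlanderIwaniecAnnals1998, Lemma 20.1] -/
theorem jacobiKubota_mul {w z : ℤ[i]} (hw : IsPrimary w) (hw' : IsPrimitive w)
    (hz : Odd z.re) (hz' : Even z.im) :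
    jacobiKubota (w * z) = (kubotaEps w.re w.im z.re z.im : ℂ) * jacobiKubota w * jacobiKubota z *
      (dirichletSym z w : ℂ) := by
  by_cases hv0 : w.im = 0
  · -- `w = 1`
    have h1 : w = 1 := eq_one_of_isPrimary_of_im_eq_zero hw hw' hv0
    subst h1
    have hε : kubotaEps (1 : ℤ[i]).re (1 : ℤ[i]).im z.re z.im = 1 := by
      unfold kubotaEps hilbertInfty; simp
    rw [one_mul, hε, jacobiKubota_one, dirichletSym_def, one_mul, Zsqrtd.norm_one]
    simp [jacobiSym.one_right]
  · -- the generic case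
    have hu : Odd w.re := Int.odd_iff.mpr (re_odd_of_isPrimary hw)
    have hv : Even w.im := by
      rcases hw with ⟨-, h⟩ | ⟨-, h⟩ <;> exact Int.even_iff.mpr (by omega)
    have h4 : 4 ∣ w.im * z.im := by
      obtain ⟨c, hc⟩ := hv; obtain ⟨d, hd⟩ := hz'; exact ⟨c * d, by rw [hc, hd]; ring⟩
    have hJ := jacobiSym_kubota (q := w.norm.natAbs) hu hv hv0 hz hz' hw' (natAbs_norm_eq_sq_add_sq w)
    have hre : (w * z).re = w.re * z.re - w.im * z.im := by rw [Zsqrtd.re_mul]; ring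
    have him : (w * z).im = w.re * z.im + w.im * z.re := Zsqrtd.im_mul w z
    rw [jacobiKubota_def, jacobiKubota_def, jacobiKubota_def, dirichletSym_eq, hre, him, hJ]
    push_cast
    have hI := I_zpow_mul_I_zpow_eq hu hz h4
    -- collect the powers of `i`
    calc Complex.I ^ ((w.re * z.re - w.im * z.im - 1) / 2) *
          ((kubotaEps w.re w.im z.re z.im : ℂ) * (kubotaSign w.re w.im z.re z.im : ℂ) *
            (J(w.im | w.re.natAbs) : ℂ) * (J(z.im | z.re.natAbs) : ℂ) *
            (J(w.re * z.re - w.im * z.im | w.norm.natAbs) : ℂ))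
        = (kubotaEps w.re w.im z.re z.im : ℂ) *
            (Complex.I ^ ((w.re * z.re - w.im * z.im - 1) / 2) * (kubotaSign w.re w.im z.re z.im : ℂ)) *
            (J(w.im | w.re.natAbs) : ℂ) * (J(z.im | z.re.natAbs) : ℂ) *
            (J(w.re * z.re - w.im * z.im | w.norm.natAbs) : ℂ) := by ring
      _ = (kubotaEps w.re w.im z.re z.im : ℂ) *
            (Complex.I ^ ((w.re - 1) / 2) * (J(w.im | w.re.natAbs) : ℂ)) *
            (Complex.I ^ ((z.re - 1) / 2) * (J(z.im | z.re.natAbs) : ℂ)) *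
            (J(w.re * z.re - w.im * z.im | w.norm.natAbs) : ℂ) := by rw [← hI]; ring


/-! ### Separation of variables in `ε(w, z)`: (20.12)–(20.15) -/

/-- **(20.12)**: `2 (x, y)_∞ = 1 + sign x + sign y - sign(xy)` for `x, y ≠ 0`.
[cite: FriedlanderIwaniecAnnals1998, (20.12)] -/
theorem two_mul_hilbertInfty {x y : ℤ} (hx : x ≠ 0) (hy : y ≠ 0) :
    2 * hilbertInfty x y = 1 + Int.sign x + Int.sign y - Int.sign (x * y) := by
  rw [Int.sign_mul]
  unfold hilbertInfty
  rcases lt_or_gt_of_ne hx with hx' | hx' <;> rcases lt_or_gt_of_ne hy with hy' | hy'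
  · rw [Int.sign_eq_neg_one_of_neg hx', Int.sign_eq_neg_one_of_neg hy']; split_ifs <;> omega
  · rw [Int.sign_eq_neg_one_of_neg hx', Int.sign_eq_one_of_pos hy']; split_ifs <;> omega
  · rw [Int.sign_eq_one_of_pos hx', Int.sign_eq_neg_one_of_neg hy']; split_ifs <;> omega
  · rw [Int.sign_eq_one_of_pos hx', Int.sign_eq_one_of_pos hy']; split_ifs <;> omega

/-- **(20.13)**: `2 (r, -v)_∞ = 1 + sign(vr) + sign r - sign v` for `r, v ≠ 0`.
[cite: FriedlanderIwaniecAnnals1998, (20.13)] -/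
theorem two_mul_hilbertInfty_neg_right {r v : ℤ} (hr : r ≠ 0) (hv : v ≠ 0) :
    2 * hilbertInfty r (-v) = 1 + Int.sign (v * r) + Int.sign r - Int.sign v := by
  rw [two_mul_hilbertInfty hr (neg_ne_zero.mpr hv)]
  simp only [Int.sign_mul, Int.sign_neg]
  ring

/-- **(20.14)**: `2 (-r, v)_∞ = 1 + sign(vr) - sign r + sign v` for `r, v ≠ 0`.
[cite: FriedlanderIwaniecAnnals1998, (20.14)] -/
theorem two_mul_hilbertInfty_neg_left {r v : ℤ} (hr : r ≠ 0) (hv : v ≠ 0) :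
    2 * hilbertInfty (-r) v = 1 + Int.sign (v * r) - Int.sign r + Int.sign v := by
  rw [two_mul_hilbertInfty (neg_ne_zero.mpr hr) hv]
  simp only [Int.sign_mul, Int.sign_neg]
  ring

/-- **(20.15)**: both cases (20.5), (20.6) of `ε = ε(w, z)` in a single form,
`2 ε(w, z) (u, v)_∞ = 1 + sign(vr) - (sign v - sign r) sign(Re wz)`, for `w = u + iv`, `z = r + is`
with `v, r ≠ 0` and `Re wz = ur - vs ≠ 0` ("The formula (20.15) reduces the problem of the separation
of variables in `ε(w, z)` to that in `sign(Re wz)`"). [cite: FriedlanderIwaniecAnnals1998, (20.15)] -/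
theorem two_mul_kubotaEps_mul_hilbertInfty {u v r s : ℤ} (hv : v ≠ 0) (hr : r ≠ 0)
    (ha : u * r - v * s ≠ 0) :
    2 * kubotaEps u v r s * hilbertInfty u v =
      1 + Int.sign (v * r) - (Int.sign v - Int.sign r) * Int.sign (u * r - v * s) := by
  have hsq : hilbertInfty u v * hilbertInfty u v = 1 := by
    unfold hilbertInfty; split_ifs <;> norm_num
  unfold kubotaEps
  rcases lt_or_gt_of_ne ha with ha' | ha'
  · rw [if_neg (not_lt.mpr ha'.le), Int.sign_eq_neg_one_of_neg ha']
    calc 2 * (hilbertInfty u v * hilbertInfty (-r) v) * hilbertInfty u v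
        = (hilbertInfty u v * hilbertInfty u v) * (2 * hilbertInfty (-r) v) := by ring
      _ = 1 + Int.sign (v * r) - (Int.sign v - Int.sign r) * -1 := by
          rw [hsq, one_mul, two_mul_hilbertInfty_neg_left hr hv]; ring
  · rw [if_pos ha', Int.sign_eq_one_of_pos ha']
    calc 2 * (hilbertInfty u v * hilbertInfty r (-v)) * hilbertInfty u v
        = (hilbertInfty u v * hilbertInfty u v) * (2 * hilbertInfty r (-v)) := by ring
      _ = 1 + Int.sign (v * r) - (Int.sign v - Int.sign r) * 1 := by
          rw [hsq, one_mul, two_mul_hilbertInfty_neg_right hr hv]; ring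


end Literature.NumberTheory.Sieve.FriedlanderIwaniecPrimes
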